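import Summits.BirchSwinnertonDyer.BirchSwinnertonDyer.Theorems.UniversalToricDescentToricKernelAtThreeDegreeOnlyTwinOfPrint
import Summits.BirchSwinnertonDyer.BirchSwinnertonDyer.Theorems.UniversalToricDescentDefectTransportModThreePTWallFree
import Summits.BirchSwinnertonDyer.BirchSwinnertonDyer.Theorems.UniversalToricDescentToricTransportModThreeStubRatSqueeze
import HarnessLib

/-!
# Route `UniversalToricDescent` — the RATIONAL road's kernel (part 1/2: §1–§2): kernel_rat `ToricKernelAtThreeApZeroOddRationalOfPrint`
# (stmt-BirchSwinnertonDyer-24208, RK-6 v2, owner LEAD bsd-wall-utd-p1) GIVEN ONE MORE INPUT — the twin's ALGEBRAIC `μ = 0`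
# (LEAD bsd-wall-utd-p1 g19, 2026-08-29; `--supports stmt-BirchSwinnertonDyer-24208`)

kernel_rat = kernel⁵ 22543's text (✓ p640116) with `DefectTransportModThreePT → AdditiveSplitIMCInclusionAtThree →` replaced by
`SigmaCongruenceAtThree → RationalSplitIMCInclusionAtThree →`. READING OF kernel⁵'s PROOF (`…KernelDegreeOnlyTwin`, `…OfPrint`): per
instance the INTEGRAL wall is used for exactly two things — `μ(X_E) = 0` (so that `Ch_Λ(X_E)·R₀⟦T⟧` has a unit-profile generator
and ♭T≤ applies) and, through GV Prop. 2.8 (`defectTransport_torsionMu_of_wall`), the TWIN's `Λ`-torsion, which un-conditions the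
twin's DEGREE clause. The twin package of the deciding chain is degree-only and `TwinMuZeroAtThree` is analytic; the RATIONAL wall
`∃ k, 3^k·𝓛 ∈ Ch·R₀⟦T⟧` bounds `μ(X_E)` by `k`, not `0`. So on the rational road the `μ`-source must come from the twin:
«`X_{∅,0}(E′/K_∞)` is `Λ`-torsion and `Ch·R₀⟦T⟧` has a generator with a norm-one coefficient» — by GV 2.8 in the tree
(`torsionMuTransportModThree`) this is EQUIVALENT to the integral wall's surplus over the rational wall. This file proves kernel_rat
GIVEN that one extra hypothesis (`hTμ`, uniform over non-additive surjective twin data), kernel-checked end to end: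

* §1 `charIdeal_eq_of_sigma_of_ratwall_of_twinMu_degreeConditional` — per-instance squeeze: wall-free ♭T≤ (p705467) ⇒
  `n′ + m ≤ n + m′`; rational wall + `μ(g) = 0` ⇒ `g ∣ 𝓛` ⇒ `n ≤ m`; degree clause ⇒ `m′ ≤ n′`; ⇒ `Ch(E)·R₀⟦T⟧ = (𝓛)`.
* §2 `bsdp_three_of_twinDegreeFrameAt_odd_of_sigma_of_ratwall` — kernel⁵'s pointwise kernel VERBATIM, `heq` from §1.
* §3 `bsdp_three_of_sigma_of_ratwall_of_degreeBucketsTR_odd` — kernel⁵'s twin trichotomy VERBATIM, `hTμ` threaded.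
* §4 `bsdp_three_of_sigma_of_ratwall_of_degreePackage_of_print` — package level (kernel_rat's eleven antecedents + `hTμ`).
* §5 `toricKernelAtThreeApZeroOddRationalOfPrint_of_twinAlgMu : hTμ-shape → ToricKernelAtThreeApZeroOddRationalOfPrint` BY NAME.

WHAT THIS SAYS TO THE PEN: 24208 AS TYPED is not closed here (and, by the reading above, has no in-tree road); `24208′ := hTμ-text →
24208` IS (§5), where the hTμ-text is a candidate item `TwinAlgMuZeroAtThree` (good-ordinary twins: print, Yan–Zhu Thm 5.7 = torsion +
equality, with 20400; multiplicative très-ramifié / good-supersingular `a₃ = 0` twins: research). HONEST FRAMING: an implication between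
route items and one displayed hypothesis; BSD is proved for no curve by this file; std axioms. References: [GreenbergVatsal2000]
Thm. (1.4), Prop. (2.8); [JetchevSkinnerWan2017] §7.4.1; [FriedbergHoffstein1995] Thm. B.
-/

noncomputable section

open scoped Classical

set_option linter.dupNamespace false
set_option autoImplicit false

namespace Summit.BirchSwinnertonDyer.BirchSwinnertonDyer.Theorems.UniversalToricDescentKernelRationalRoad

open WeierstrassCurve NumberField IsDedekindDomain Field
  Literature.NumberTheory.EllipticCurves
  Literature.NumberTheory.EllipticCurves.ModularForms
  Literature.NumberTheory.EllipticCurves.Rank1Residual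
  Literature.NumberTheory.EllipticCurves.KrizLi2019
  Literature.NumberTheory.EllipticCurves.LiuZhangZhang2018
  Summit.BirchSwinnertonDyer.Rank1Residual
  Summit.BirchSwinnertonDyer.Rank1Residual.Additive
  Summit.BirchSwinnertonDyer.Rank1Residual.X11b
  Summit.BirchSwinnertonDyer.Rank1Residual.X11b.AcSelmer
  Summit.BirchSwinnertonDyer.Rank1Residual.X11b.Halves
  Summit.BirchSwinnertonDyer.BirchSwinnertonDyer.Theses.UniversalToricDescent
  Summit.BirchSwinnertonDyer.BirchSwinnertonDyer.Theorems
  Summit.BirchSwinnertonDyer.BirchSwinnertonDyer.Theorems.UniversalToricDescentTwinChoice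
  Summit.BirchSwinnertonDyer.BirchSwinnertonDyer.Theorems.UniversalToricDescentWaldspurgerFlat
  Summit.BirchSwinnertonDyer.BirchSwinnertonDyer.Theorems.UniversalToricDescentKernelOdd
  Summit.BirchSwinnertonDyer.BirchSwinnertonDyer.Theorems.UniversalToricDescentKernelOfPrint
  Summit.BirchSwinnertonDyer.BirchSwinnertonDyer.Theorems.UniversalToricDescentKernelFlatOfPrint
  Summit.BirchSwinnertonDyer.BirchSwinnertonDyer.Theorems.UniversalToricDescentActDFlatGlue
  Summit.BirchSwinnertonDyer.BirchSwinnertonDyer.Theorems.UniversalToricDescentNormProfile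
  Summit.BirchSwinnertonDyer.BirchSwinnertonDyer.Theorems.UniversalToricDescentDefectTransport
  Summit.BirchSwinnertonDyer.BirchSwinnertonDyer.Theorems.UniversalToricDescentDefectPTSqueeze
  Summit.BirchSwinnertonDyer.BirchSwinnertonDyer.Theorems.UniversalToricDescentKernelDefectPTOfPrint
  Summit.BirchSwinnertonDyer.BirchSwinnertonDyer.Theorems.UniversalToricDescentKernelDefectPTTROfPrint
  Summit.BirchSwinnertonDyer.BirchSwinnertonDyer.Theorems.UniversalToricDescentKernelDegreeOnlyTwin
  Summit.BirchSwinnertonDyer.BirchSwinnertonDyer.Theorems.UniversalToricDescentKernelDegreeOnlyTwinOfPrint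
  Summit.BirchSwinnertonDyer.BirchSwinnertonDyer.Cruxes.ToricTransportModThree

/-! ### §1 The per-instance squeeze of the rational road (degree currency) -/

section Squeeze

variable (W : WeierstrassCurve ℚ) [W.IsElliptic] [W.IsGloballyMinimal] (W' : WeierstrassCurve ℚ) [W'.IsElliptic]
  [W'.IsGloballyMinimal] (N N' : ℕ) [NeZero N] [NeZero N'] (K : Type) [Field K] [NumberField K]
  (Dt : ModularParametrizationData W N) (Dt' : ModularParametrizationData W' N')

/-- **The cross-squeeze of the RATIONAL road, DEGREE currency** (kernel⁵'s §1 `charIdeal_eq_of_defectPT_of_wall_of_mu_degreeConditional`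
with the wild-side inputs `(♭T≤, wall, wild torsion)` REPLACED by `(A, rational wall, twin torsion + μ = 0 generator)`): at the
`E`-frame `L`, `Ch_Λ(X_E)·R₀⟦T⟧ = (L)`. Steps: wall-free ♭T≤ from A and the twin's algebraic `μ = 0` (`…WallFree`, p705467: Poitou–Tate
discharged, `μ(X_E) = 0` and wild torsion by GV 2.8 `torsionMuTransportModThree`) returns `(g, g′, n, m, n′, m′)` with `n′ + m ≤ n + m′`;
the rational wall `3^k·L ∈ (g)` with `μ(g) = 0` gives `g ∣ L` (`RatwallThinComb.dvd_of_dvd_prime_pow_mul`, p703763) hence `n ≤ m`;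
the twin's degree clause (its torsion premise is `hTμ'.1`) gives `m′ ≤ n′`; so `n = m` and `span_eq_span_of_dvd_of_normProfile`.
[cite: GreenbergVatsal2000, Thm. (1.4), Prop. (2.8)] [cite: JetchevSkinnerWan2017, §7.4.1] -/
theorem charIdeal_eq_of_sigma_of_ratwall_of_twinMu_degreeConditional (hA : SigmaCongruenceAtThree)
    (hrat : RationalSplitIMCInclusionAtThree) (hmu : TwinMuZeroAtThree)
    (hO6 : Additive.ClassO6 W 3) (hsurj : W.HasSurjectiveModNGaloisRep 3) (hr : W.analyticRank = 1)
    (hN : W.conductorNorm ℤ = N) (hcong : O6.ModPCongruent W' W 3) (hss : ¬ Addv W' 3) (hN' : W'.conductorNorm ℤ = N')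
    (hK : IsImaginaryQuadratic K) (hHN : SatisfiesHeegnerHypothesis N K) (hHN' : SatisfiesHeegnerHypothesis N' K)
    (hfinE : ∀ (v : HeightOneSpectrum (𝓞 K)), ((3 : ℕ) : 𝓞 K) ∈ v.asIdeal → Finite (selmerAcBase (W.baseChange K) 3 v ∅))
    (κ : ZpExtension K 3) (hκ : κ.IsAnticyclotomic) (γ : absoluteGaloisGroup K) [Fact (κ.IsTopGenerator γ)]
    (𝔭 : HeightOneSpectrum (𝓞 K)) (h𝔭 : ((3 : ℕ) : 𝓞 K) ∈ 𝔭.asIdeal) (he : 𝔭.asIdeal.ramificationIdx (𝓞 ℚ) = 1)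
    (hf : 𝔭.asIdeal.inertiaDeg (𝓞 ℚ) = 1) (𝔭' : HeightOneSpectrum (𝓞 K)) (h𝔭' : ((3 : ℕ) : 𝓞 K) ∈ 𝔭'.asIdeal)
    (hne : 𝔭' ≠ 𝔭) (ι' : PadicAlgCl 3 ≃+* ℂ) (hind : SchneiderFree.BranchInducesPrime 3 ι' 𝔭)
    (hTμ' : Module.IsTorsion (IwasawaAlgebra 3) (XAc (W'.baseChange K) 3 κ 𝔭' ∅ γ) ∧
          ∃ g' : UnrSeries 3, (XAc.charIdeal (W'.baseChange K) 3 κ 𝔭' ∅ γ).map (PowerSeries.map (toUnr 3)) =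
            Ideal.span {g'} ∧ ∃ i : ℕ, ‖((PowerSeries.coeff i g' : unrIntegers 3) : ℂ_[3])‖ = 1)
    (hdeg : ∃ (ΩK' : ℂ) (Ωp' : ℂ_[3]) (L' : UnrSeries 3), ΩK' ≠ 0 ∧ Ωp' ≠ 0 ∧ IsBDPLFunction ι' 𝔭 κ γ Dt'.f ΩK' Ωp' L' ∧
      (Module.IsTorsion (IwasawaAlgebra 3) (XAc (W'.baseChange K) 3 κ 𝔭' ∅ γ) →
        ∀ (g : UnrSeries 3) (n m : ℕ),
          (XAc.charIdeal (W'.baseChange K) 3 κ 𝔭' ∅ γ).map (PowerSeries.map (toUnr 3)) = Ideal.span {g} →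
          (∀ i < n, ‖((PowerSeries.coeff i g : unrIntegers 3) : ℂ_[3])‖ < 1) ∧
              ‖((PowerSeries.coeff n g : unrIntegers 3) : ℂ_[3])‖ = 1 →
          (∀ i < m, ‖((PowerSeries.coeff i L' : unrIntegers 3) : ℂ_[3])‖ < 1) ∧
              ‖((PowerSeries.coeff m L' : unrIntegers 3) : ℂ_[3])‖ = 1 →
          m ≤ n))
    {ΩK : ℂ} {Ωp : ℂ_[3]} {L : UnrSeries 3} (hΩK : ΩK ≠ 0) (hΩp : Ωp ≠ 0)
    (hBDP : IsBDPLFunction ι' 𝔭 κ γ Dt.f ΩK Ωp L) :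
    (XAc.charIdeal (W.baseChange K) 3 κ 𝔭' ∅ γ).map (PowerSeries.map (toUnr 3)) = Ideal.span {L} := by
  -- kernel⁵'s §1 with `hle` no longer GIVEN by the wall but RECOVERED from the rational wall + the twin's algebraic μ = 0
  obtain ⟨ΩK', Ωp', L', hΩK', hΩp', hBDP', hdegT⟩ := hdeg
  have hi' : ∃ i : ℕ, ‖((PowerSeries.coeff i L' : unrIntegers 3) : ℂ_[3])‖ = 1 :=
    hmu W W' N N' K Dt Dt' hO6 hsurj hr hN hcong hss hN' hK hHN hHN' κ hκ γ 𝔭 h𝔭 he hf 𝔭' h𝔭' hne ι' hind ΩK' Ωp' L'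
      hΩK' hΩp' hBDP'
  obtain ⟨k, hk⟩ := hrat W N K Dt hO6 hsurj hr hN hK hHN κ hκ γ 𝔭 h𝔭 he hf 𝔭' h𝔭' hne ι' hind ΩK Ωp L hΩK hΩp hBDP
  obtain ⟨g, g', n, m, n', m', hIE, hI', hg, hL, hg', hL', hsum⟩ :=
    UniversalToricDescentDefectTransportModThreePTWallFree.defectTransportPT_wallFree_of_sigmaCongruence hA W W' N N' K Dt Dt'
      hO6 hsurj hr hN hcong hss hN' hK hHN hHN' hfinE κ hκ γ 𝔭 𝔭' h𝔭 he hf h𝔭' hne ι' hind hTμ'.1 hTμ'.2 ΩK Ωp L hΩK hΩp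
      hBDP ΩK' Ωp' L' hΩK' hΩp' hBDP' hi'
  have hgdvd : g ∣ ((3 : ℕ) : UnrSeries 3) ^ k * L := Ideal.mem_span_singleton.mp (hIE ▸ hk)
  rw [← map_natCast (PowerSeries.C (R := unrIntegers 3))] at hgdvd
  have hgL : g ∣ L :=
    RatwallThinComb.dvd_of_dvd_prime_pow_mul RatwallThinComb.prime_C_three
      (RatwallThinComb.not_C_three_dvd_of_norm_coeff_eq_one hg.2) k hgdvd
  have h₁ : n ≤ m := firstUnitCoeff_le_of_dvd hgL hg.1 hL.2
  have h₂ : m' ≤ n' := hdegT hTμ'.1 g' n' m' hI' hg' hL'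
  have hnm : n = m := by omega
  subst hnm
  exact hIE.trans (span_eq_span_of_dvd_of_normProfile hgL hg.1 hL.2)

end Squeeze

/-! ### §2 The pointwise kernel of the rational road -/

/-- **Pointwise kernel of the RATIONAL road** = `…KernelDegreeOnlyTwin.bsdp_three_of_twinDegreeFrameAt_odd_of_defectPT` (kernel⁵'s §2)
VERBATIM except: the wild-side binders `(hD : DefectTransportModThreePT) (hwall : AdditiveSplitIMCInclusionAtThree)` are replaced by
`(hA : SigmaCongruenceAtThree) (hrat : RationalSplitIMCInclusionAtThree)`, the Cassels–Poitou–Tate binder is dropped (discharged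
inside §1), and ONE pointwise twin hypothesis is ADDED — `hTμ'`: at every frame datum of the handed twin `W′`, `X_{∅,0}(W′/K_∞)` is
`Λ`-torsion and `Ch·R₀⟦T⟧` has a generator with a norm-one coefficient (the twin's ALGEBRAIC `μ = 0`; the `μ`-source the rational
road needs and the degree package does not carry). `heq` comes from §1. CONDITIONAL on every displayed hypothesis; BSD is
proved for no curve by this. [cite: JetchevSkinnerWan2017, §7.4.1] [cite: FriedbergHoffstein1995, Thm. B] [cite: GreenbergVatsal2000, Thm. (1.4), Prop. (2.8)] -/
theorem bsdp_three_of_twinDegreeFrameAt_odd_of_sigma_of_ratwall (hF : ToricPublishedInputs)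
    (hA : SigmaCongruenceAtThree) (hrat : RationalSplitIMCInclusionAtThree) (hmu : TwinMuZeroAtThree)
    (hPT : PoitouTateSelmerStructureDualityFact)
    (hV : ∀ (W : WeierstrassCurve ℚ) [W.IsElliptic] [W.IsGloballyMinimal] (N : ℕ) [NeZero N] (K : Type)
      [Field K] [NumberField K] (Dt : ModularParametrizationData W N) (H : HeegnerDatum N (NumberField.discr K))
      (ι : K →+* ℂ) (P : (W.baseChange K).toAffine.Point),
      Additive.ClassO6 W 3 → W.HasSurjectiveModNGaloisRep 3 → W.analyticRank = 1 → W.conductorNorm ℤ = N →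
      IsImaginaryQuadratic K → SatisfiesHeegnerHypothesis N K → Odd (NumberField.discr K) →
      (W.quadraticTwist (NumberField.discr K : ℚ)).entireLFunction 1 ≠ 0 →
      (WeierstrassCurve.Affine.Point.map ι.toRatAlgHom) P = heegnerPointComplex Dt H → ¬ IsOfFinAddOrder P →
      ∀ (κ : ZpExtension K 3), κ.IsAnticyclotomic → ∀ (γ : absoluteGaloisGroup K) [Fact (κ.IsTopGenerator γ)]
        (𝔭 : HeightOneSpectrum (𝓞 K)) (h𝔭 : ((3 : ℕ) : 𝓞 K) ∈ 𝔭.asIdeal)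
        (he : 𝔭.asIdeal.ramificationIdx (𝓞 ℚ) = 1) (hf : 𝔭.asIdeal.inertiaDeg (𝓞 ℚ) = 1),
        ∃ ι' : PadicAlgCl 3 ≃+* ℂ, SchneiderFree.BranchInducesPrime 3 ι' 𝔭 ∧
          ∃ (ΩK : ℂ) (Ωp : ℂ_[3]) (L : UnrSeries 3), ΩK ≠ 0 ∧ Ωp ≠ 0 ∧ IsBDPLFunction ι' 𝔭 κ γ Dt.f ΩK Ωp L ∧
            ∃ u : (unrIntegers 3)ˣ, L.HasValueAt 0 ((((u : unrIntegers 3) : unrIntegers 3) : ℂ_[3]) *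
              (algebraMap ℚ_[3] ℂ_[3] (logOmega W 3 (embAt K 3 𝔭 h𝔭 he hf) P / (Dt.c : ℚ_[3]))) ^ 2))
    (hC : WildSplitControlAtThree) (hZ : WildRankZeroTwistAtThree)
    (W : WeierstrassCurve ℚ) [W.IsElliptic] [W.IsGloballyMinimal]
    (hO6 : Additive.ClassO6 W 3) (hr : W.analyticRank = 1) (hsurj : W.HasSurjectiveModNGaloisRep 3)
    (W' : WeierstrassCurve ℚ) [W'.IsElliptic] [W'.IsGloballyMinimal]
    (hcong : O6.ModPCongruent W' W 3) (hW'ss : ¬ Addv W' 3)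
    (hI' : ∀ (N' : ℕ) [NeZero N'] (K : Type) [Field K] [NumberField K]
      (Dt' : ModularParametrizationData W' N'), W'.conductorNorm ℤ = N' → IsImaginaryQuadratic K →
      SatisfiesHeegnerHypothesis N' K → Odd (NumberField.discr K) →
      ∀ (κ : ZpExtension K 3), κ.IsAnticyclotomic →
      ∀ (γ : absoluteGaloisGroup K) [Fact (κ.IsTopGenerator γ)] (𝔭 : HeightOneSpectrum (𝓞 K)),
        ((3 : ℕ) : 𝓞 K) ∈ 𝔭.asIdeal → 𝔭.asIdeal.ramificationIdx (𝓞 ℚ) = 1 →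
        𝔭.asIdeal.inertiaDeg (𝓞 ℚ) = 1 →
      ∀ (𝔭' : HeightOneSpectrum (𝓞 K)), ((3 : ℕ) : 𝓞 K) ∈ 𝔭'.asIdeal → 𝔭' ≠ 𝔭 →
      ∀ (ι' : PadicAlgCl 3 ≃+* ℂ), SchneiderFree.BranchInducesPrime 3 ι' 𝔭 →
        ∃ (ΩK : ℂ) (Ωp : ℂ_[3]) (L' : UnrSeries 3), ΩK ≠ 0 ∧ Ωp ≠ 0 ∧
          IsBDPLFunction ι' 𝔭 κ γ Dt'.f ΩK Ωp L' ∧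
          (Module.IsTorsion (IwasawaAlgebra 3) (XAc (W'.baseChange K) 3 κ 𝔭' ∅ γ) →
            ∀ (g : UnrSeries 3) (n m : ℕ),
              (XAc.charIdeal (W'.baseChange K) 3 κ 𝔭' ∅ γ).map (PowerSeries.map (toUnr 3)) = Ideal.span {g} →
              (∀ i < n, ‖((PowerSeries.coeff i g : unrIntegers 3) : ℂ_[3])‖ < 1) ∧
                  ‖((PowerSeries.coeff n g : unrIntegers 3) : ℂ_[3])‖ = 1 →
              (∀ i < m, ‖((PowerSeries.coeff i L' : unrIntegers 3) : ℂ_[3])‖ < 1) ∧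
                  ‖((PowerSeries.coeff m L' : unrIntegers 3) : ℂ_[3])‖ = 1 →
              m ≤ n))
    (hTμ' : ∀ (N' : ℕ) [NeZero N'] (K : Type) [Field K] [NumberField K] (Dt' : ModularParametrizationData W' N'),
      W'.conductorNorm ℤ = N' → IsImaginaryQuadratic K → SatisfiesHeegnerHypothesis N' K →
      ∀ (κ : ZpExtension K 3), κ.IsAnticyclotomic →
      ∀ (γ : absoluteGaloisGroup K) [Fact (κ.IsTopGenerator γ)] (𝔭 : HeightOneSpectrum (𝓞 K)),
        ((3 : ℕ) : 𝓞 K) ∈ 𝔭.asIdeal → 𝔭.asIdeal.ramificationIdx (𝓞 ℚ) = 1 →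
        𝔭.asIdeal.inertiaDeg (𝓞 ℚ) = 1 →
      ∀ (𝔭' : HeightOneSpectrum (𝓞 K)), ((3 : ℕ) : 𝓞 K) ∈ 𝔭'.asIdeal → 𝔭' ≠ 𝔭 →
        Module.IsTorsion (IwasawaAlgebra 3) (XAc (W'.baseChange K) 3 κ 𝔭' ∅ γ) ∧
          ∃ g' : UnrSeries 3, (XAc.charIdeal (W'.baseChange K) 3 κ 𝔭' ∅ γ).map (PowerSeries.map (toUnr 3)) =
            Ideal.span {g'} ∧ ∃ i : ℕ, ‖((PowerSeries.coeff i g' : unrIntegers 3) : ℂ_[3])‖ = 1) :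
    BSDp W 3 := by
  -- VERBATIM `…KernelDegreeOnlyTwin.bsdp_three_of_twinDegreeFrameAt_odd_of_defectPT` (w2 g6 ← w2 g3 ← p609468 utd-p1 g11); the ONE change is `heq` («rat»)
  obtain ⟨hGZ, hKo, hGZK, hmod, hmodP, -, hGZ73, hFH, hpar, hHP⟩ := hF
  haveI hN0 : NeZero (W.conductorNorm ℤ) := ⟨W.conductorNorm_pos_holds.ne'⟩
  haveI hN0' : NeZero (W'.conductorNorm ℤ) := ⟨W'.conductorNorm_pos_holds.ne'⟩
  have hw : W.rootNumber = -1 := by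
    rcases W.rootNumber_eq_one_or with h | h
    · exfalso
      have heven : Even W.analyticRank := (hpar W).mpr h
      rw [hr] at heven
      exact Nat.not_even_one heven
    · exact h
  obtain ⟨K, _, _, hK, -, hHN, hH2N', hLt⟩ :=
    hFH W hw (2 * W'.conductorNorm ℤ) (mul_ne_zero two_ne_zero hN0'.out) 0
  have hHN' : SatisfiesHeegnerHypothesis (W'.conductorNorm ℤ) K :=
    SatisfiesHeegnerHypothesis.of_dvd (dvd_mul_left _ 2) hH2N'
  have hodd : Odd (NumberField.discr K) := by
    have h8 := Literature.SatisfiesHeegnerHypothesis.discr_emod_eight hK.1 hH2N' (dvd_mul_right 2 _)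
    rw [Int.odd_iff]; omega
  have h3N : 3 ∣ W.conductorNorm ℤ :=
    (W.dvd_conductorNorm_iff_not_hasGoodReductionAtPrime 3).mpr (not_good_of_addv W 3 hO6.2.1)
  have hsplit : SplitsIn K 3 := hHN 3 Nat.prime_three h3N
  obtain ⟨P, Dt, H, ι, hP⟩ := hHP W K hK hHN
  have hL0 : W.entireLFunction 1 = 0 := entireLFunction_one_eq_zero_of_analyticRank_eq_one hr
  obtain ⟨-, hderiv⟩ := leadingLCoeff_eq_deriv_of_analyticRank_eq_one hr
  have hLK : LDerivEK W K ≠ 0 := by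
    rw [lDerivEK_eq_deriv_mul W K hmod hL0]; exact mul_ne_zero hderiv hLt
  have hnt : ¬ IsOfFinAddOrder P :=
    (lDerivEK_ne_zero_iff_not_isOfFinAddOrder W (W.conductorNorm ℤ) K (hGZ _ W K) hK hHN
      ⟨Dt, H, ι, hP⟩).mp hLK
  obtain ⟨hrk, hfin⟩ := hKo (W.conductorNorm ℤ) W K hK hHN ⟨Dt, H, ι, hP⟩ hnt
  obtain ⟨Dt'⟩ := hmodP W'
  obtain ⟨κ, γ, -, hκ, hγ, -⟩ := X11b.exists_anticyclotomic_generator_prime (p := 3) hK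
  haveI : Fact (κ.IsTopGenerator γ) := ⟨hγ⟩
  obtain ⟨𝔭, h𝔭, he, hf⟩ := X11b.exists_degreeOnePrime_of_splitsIn K 3 hK.1 hsplit
  obtain ⟨𝔭', hne, h𝔭', he', hf'⟩ := X11b.Three.exists_ne_degreeOne_prime hK.1 h𝔭 he hf
  obtain ⟨ι', hind, ΩK, Ωp, L, hΩK, hΩp, hBDP, u, hval⟩ :=
    hV W (W.conductorNorm ℤ) K Dt H ι P hO6 hsurj hr rfl hK hHN hodd hLt hP hnt κ hκ γ 𝔭 h𝔭 he hf
  -- «deg»: the twin's frame with its TORSION-CONDITIONAL DEGREE clause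
  have hdeg' := hI' (W'.conductorNorm ℤ) K Dt' rfl hK hHN' hodd κ hκ γ 𝔭 h𝔭 he hf 𝔭' h𝔭' hne ι' hind
  have hctl : SchneiderFree.AdditiveControlOnTreeAt 3 κ 𝔭' γ (embAt K 3 𝔭' h𝔭' he' hf') P :=
    hC W (W.conductorNorm ℤ) K Dt H ι P hO6 hsurj hr rfl hK hHN hLt hP hnt (hKo _ W K) κ hκ γ 𝔭'
      h𝔭' he' hf'
  obtain ⟨n, hn, hneq⟩ := hctl
  -- «act E»: the wild curve's base finiteness at every `v ∋ 3`, from rank-one data over `K`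
  have hfinE : ∀ (v : HeightOneSpectrum (𝓞 K)), ((3 : ℕ) : 𝓞 K) ∈ v.asIdeal →
      Finite (selmerAcBase (W.baseChange K) 3 v ∅) := by
    intro v hv
    haveI : Finite (W.baseChange K).sha := hfin
    have hSha3 : Finite (AddCommGroup.primaryComponent (W.baseChange K).sha 3) := inferInstance
    obtain ⟨he'', hf''⟩ := X11b.degreeOne_of_splitsIn hK.1 hsplit hv
    obtain ⟨hfinv, -⟩ :=
      SchneiderFreeAdditiveX3.natCard_selmerAcBase_mul_eq_of_rankOne_anyTorsion_shaPrimary W 3 K (hPT K)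
        (localEulerPoincareCharacteristicFact_proof K) hK hsplit hrk hSha3 P hnt v hv he'' hf''
    exact hfinv
  -- «rat»: A → rational wall → twin algebraic μ → μ squeeze in the DEGREE currency (§1): IMC EQUALITY for `E` at `L`
  have hTμi := hTμ' (W'.conductorNorm ℤ) K Dt' rfl hK hHN' κ hκ γ 𝔭 h𝔭 he hf 𝔭' h𝔭' hne
  have heq : (XAc.charIdeal (W.baseChange K) 3 κ 𝔭' ∅ γ).map (PowerSeries.map (toUnr 3)) =
      Ideal.span {L} :=
    charIdeal_eq_of_sigma_of_ratwall_of_twinMu_degreeConditional W W' (W.conductorNorm ℤ) (W'.conductorNorm ℤ) K Dt Dt'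
      hA hrat hmu hO6 hsurj hr rfl hcong hW'ss rfl hK hHN hHN' hfinE κ hκ γ 𝔭 h𝔭 he hf 𝔭' h𝔭' hne ι' hind
      hTμi hdeg' hΩK hΩp hBDP
  have hval' : L.HasValueAt 0 ((((u : unrIntegers 3) : unrIntegers 3) : ℂ_[3]) *
      (algebraMap ℚ_[3] ℂ_[3]
        (logOmega W 3 (embAt K 3 𝔭' h𝔭' he' hf') P / (Dt.c : ℚ_[3]))) ^ 2) :=
    (SchneiderFreeAdditiveX3.hasValueAt_sq_logOmega_embAt_iff_of_rank_one W 3 hK.1 hrk h𝔭 he hf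
      h𝔭' he' hf' P _ _ L).mpr hval
  have hc0 : Dt.c ≠ 0 := Dt.maninConstant_ne_zero_holds
  have hlog : logOmega W 3 (embAt K 3 𝔭' h𝔭' he' hf') P ≠ 0 := X11b.R1.logOmega_ne_zero W 3 _ hnt
  have hlow : SchneiderFree.AdditiveIMCLowerBDPOnTreeLeAt 3 κ 𝔭' γ (embAt K 3 𝔭' h𝔭' he' hf')
      (padicValNat 3 Dt.c.natAbs) P := by
    obtain ⟨htors, f, hfI, hf0, hfn⟩ := hn
    have hmem : PowerSeries.map (toUnr 3) f ∈ Ideal.span {L} := by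
      have h3 := heq.le
      rw [hfI, CongruenceLimit.map_span_singleton_powerSeries] at h3
      exact (Ideal.span_singleton_le_iff_mem _).mp h3
    obtain ⟨-, hle⟩ := Supersingular.two_mul_valuation_le_of_mem_span 3 hf0 hmem u hval'
    have hc0' : (Dt.c : ℚ_[3]) ≠ 0 := by exact_mod_cast hc0
    rw [div_eq_mul_inv, Padic.valuation_mul hlog (inv_ne_zero hc0'), Padic.valuation_inv,
      Padic.valuation_intCast, valuation_logOmega hlog, hfn] at hle
    refine ⟨n, ⟨htors, f, hfI, hf0, hfn⟩, ?_⟩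
    simp only [padicValInt] at hle
    linarith
  have hup : SchneiderFree.Upper.AdditiveIMCUpperBDPOnTreeLeAt 3 κ 𝔭' γ (embAt K 3 𝔭' h𝔭' he' hf')
      (padicValNat 3 Dt.c.natAbs) P :=
    SchneiderFree.Upper.additiveIMCUpperBDPOnTreeLeAt_of_value_of_dvd' hn heq.ge u hc0 hlog hval'
  have hlo : SchneiderFree.IndexLowerBoundLeAt W 3 K P (padicValNat 3 Dt.c.natAbs) :=
    SchneiderFreeAdditiveX3.indexLowerBoundLeAt_of_imcLowerLe_of_control rfl hK hHN hfin hlow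
      ⟨n, hn, hneq⟩
  have hupI : SchneiderFree.Upper.IndexUpperBoundLeAt W 3 K P (padicValNat 3 Dt.c.natAbs) :=
    SchneiderFree.Upper.indexUpperBoundLeAt_of_imcUpperLe_of_control rfl hK hHN hfin hup ⟨n, hn, hneq⟩
  have hD0 : (NumberField.discr K : ℚ) ≠ 0 := by exact_mod_cast NumberField.discr_ne_zero K
  haveI : (W.quadraticTwist (NumberField.discr K : ℚ)).IsElliptic := W.isElliptic_quadraticTwist hD0
  obtain ⟨Cd, hCd⟩ := hasGlobalMinimalModel_rat_holds (W.quadraticTwist (NumberField.discr K : ℚ))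
  haveI : (Cd • W.quadraticTwist (NumberField.discr K : ℚ)).IsGloballyMinimal := hCd
  exact SchneiderFree.Exact.bsdp_three_of_exactIndexManin_of_wAllExclAddWildRankZero hGZ hKo hGZK hmod
    hGZ73 hZ W hO6 hsurj hr (W.conductorNorm ℤ) K Dt H ι P
    (Cd • W.quadraticTwist (NumberField.discr K : ℚ)) rfl hK hodd hHN hLt hP ⟨Cd, rfl⟩ hlo hupI


end Summit.BirchSwinnertonDyer.BirchSwinnertonDyer.Theorems.UniversalToricDescentKernelRationalRoad

end
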